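import Literature.AnabelianGeometry.EtaleTheta.BiKummer
import Literature.AlgebraicGeometry.Frobenioids.PreFrobenioidDataOfModel

/-!
# [EtTh] Def. 3.6 (ii)(b) ⇒ NO object of a tempered Frobenioid is group-like: `Φ(A) ≠ 0` for every `A` — the §5 binder
# `hN` DISCHARGED for every tempered Frobenioid (§3 p.303 / PDF p.77)

Mochizuki, *The étale theta function and its Frobenioid-theoretic manifestations*, Publ. RIMS **45** (2009), Def. 3.6 (ii) p.303
(PDF p.77) [cite: MochizukiEtTh2009, Def 3.6 (ii) p.303 (PDF p.77)]; Mochizuki, *The geometry of Frobenioids I*, Kyushu J. Math.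
**62** (2008), Def. 1.2 (iv) p.23 [cite: MochizukiFrdI2008, Def. 1.2 (iv) p.23].  abc-iut cell, cross-layer piece by signature for layer L2 (seat
abc-iut-w4-d008, gen 4).  PROOF-ONLY over abc-iut-L2-t3's `TemperedFrobenioid` (Def. 3.6 (ii) data) and abc-iut-L1's
`PreFrobenioidData.ofModel` ([FrdI] Thm. 5.2 model); 0 definitions, no new named fact.

WHAT.  Def. 3.6 (ii)(b) (p.303): "the image of the resulting homomorphism of group-like monoids on `D`,
`F := F₀^Λ|_D ×_{(Φ^{ℝ-log})^gp} Φ^gp → (Φ^{bs-fld})^gp`, … determines a subfunctor in NONZERO monoids of `(Φ^{bs-fld})^gp` [i.e., for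
every `A ∈ Ob(D)`, the homomorphism `F(A) → (Φ^{bs-fld})^gp(A)` is nonzero]" — typed by abc-iut-L2-t3 as the field
`TemperedFrobenioid.exists_FΛ_div_ne : ∀ A, ∃ b ∈ F₀^Λ, ∃ x y ∈ Φ(A), x ≠ y ∧ Div(b) = x/y`.  In particular `Φ(A)` has an element
`≠ 1` for EVERY `A ∈ Ob(D)` (`exists_divisorMonoid_ne_one`), so NO object `(A, α)` of the tempered Frobenioid `C` is group-like in
the sense of abc-iut-L1's `PreFrobenioidData.IsGroupLikeObj` (`Φ(A_D) = 0`; [FrdI] Def. 1.2 (iv) p.23) at the `PreFrobenioidData.ofModel`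
presentation: `not_isGroupLikeObj_ofModel` (EVERY object; the `∃`-form at the `ofFunctor … toElem` presentation is abc-iut-L6-t13 /
abc-iut-w6's `TemperedFrobenioid.exists_not_isGroupLikeObj` via Thm. 3.7 (i), `Discharge/Sec3Cor38iiiFSM.lean`); and since `D` is
connected, hence nonempty, **`exists_not_isGroupLikeObj_ofModel`**: `∃ A ∈ Ob(C), ¬ group-like` — the binder `hN` of abc-iut-L2-d4's
Thm. 5.7 family files (`thetaRootPreservedAll_ofConnectedTemperoid(Ydd)Family`, p429665 / p430430; classed "(A) GENUINE-INSTANCE-ONLY"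
in the 2026-08-26T07:25Z binder census) holds for EVERY tempered Frobenioid — `BiKummerSetting.exists_not_isGroupLikeObj` in the
exact shape `∃ A : S.C, ¬ (PreFrobenioidData.ofModel S.tf.divisorMonoid S.tf.ratFnFunctor S.tf.divBNatTrans).IsGroupLikeObj A`.
HONEST FRAMING: a kernel-checked consequence of the typed Def. 3.6 (ii) data; nothing asserts such data exist for an actual curve;
no side taken on [IUTchIII] Cor. 3.12; typed ≠ proved for anything else.
-/

namespace Literature.AnabelianGeometry.EtaleTheta

open CategoryTheory Opposite Literature.AlgebraicGeometry.Frobenioids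

universe u₀ v₀ u v w

namespace TemperedFrobenioid

variable {D₀ : Type u₀} [Category.{v₀} D₀] {V : FrdIMonoidStub.{w}} {T : RealifiedDivisorMonoids (D₀ := D₀) V}
  {D : Type u} [Category.{v} D] {VD : FrdICatStub.{u, v, w} D} (C : TemperedFrobenioid T D VD)

/-- **Def. 3.6 (ii)(b) ⇒ `Φ(A) ≠ 0`**: for every `A ∈ Ob(D)` the divisor monoid `Φ(A)` of a tempered Frobenioid has an element
`≠ 1` (two DISTINCT elements `x ≠ y ∈ Φ(A)` occur in `Div(b) = x/y` for some constant `b`, p.303 (PDF p.77)).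
[cite: MochizukiEtTh2009, Def 3.6 (ii) p.303 (PDF p.77)] -/
theorem exists_divisorMonoid_ne_one (A : Dᵒᵖ) : ∃ z : C.divisorMonoid.obj A, z ≠ 1 := by
  obtain ⟨-, -, x, hx, y, hy, hxy, -⟩ := C.exists_FΛ_div_ne A
  by_cases h1 : (⟨x, hx⟩ : C.Φ.carrier A) = 1
  · refine ⟨⟨y, hy⟩, fun h2 => hxy ?_⟩
    exact (congrArg Subtype.val h1).trans (congrArg Subtype.val h2).symm
  · exact ⟨⟨x, hx⟩, h1⟩

/-- **No object of a tempered Frobenioid is group-like** ([FrdI] Def. 1.2 (iv) p.23: `A` group-like iff `Φ(A_D) = 0`; abc-iut-L1's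
`PreFrobenioidData.IsGroupLikeObj` at the [FrdI] Thm. 5.2 model of Def. 3.6 (ii)).
[cite: MochizukiEtTh2009, Def 3.6 (ii) p.303 (PDF p.77)] -/
theorem not_isGroupLikeObj_ofModel (A : C.category) :
    ¬ (PreFrobenioidData.ofModel C.divisorMonoid C.ratFnFunctor C.divBNatTrans).IsGroupLikeObj A := by
  intro hA
  obtain ⟨z, hz⟩ := C.exists_divisorMonoid_ne_one (op A.base)
  exact hz (hA z)

/-- **`∃ A ∈ Ob(C)`, `A` not group-like** — the §5 binder `hN` for EVERY tempered Frobenioid (`D` is connected, Def. 3.6 (ii),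
hence nonempty; take `(A_D, 0)` for any `A_D`).  [cite: MochizukiEtTh2009, Def 3.6 (ii) p.303 (PDF p.77)] -/
theorem exists_not_isGroupLikeObj_ofModel :
    ∃ A : C.category, ¬ (PreFrobenioidData.ofModel C.divisorMonoid C.ratFnFunctor C.divBNatTrans).IsGroupLikeObj A := by
  haveI := C.isConnected
  obtain ⟨A₀⟩ := (inferInstance : Nonempty D)
  exact ⟨⟨A₀, 1⟩, C.not_isGroupLikeObj_ofModel _⟩

end TemperedFrobenioid

namespace BiKummerSetting

variable {K : Type u₀} [Field K] {X : SemiGraphs.TemperedArithmeticGroup.{u₀} K} {D₀ : Type u₀} [Category.{v₀} D₀]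
  {V : FrdIMonoidStub.{w}} {T₀ : RealifiedDivisorMonoids (D₀ := D₀) V} {D : Type u} [Category.{v} D]
  {VD : FrdICatStub.{u, v, w} D} (S : BiKummerSetting X T₀ D VD)

/-- **The §5 binder `hN` at any [EtTh] §4 bi-Kummer setting** (exact shape of abc-iut-L2-d4's Thm. 5.7 family files): some — in
fact every — object of `C` is not group-like.  [cite: MochizukiEtTh2009, Def 3.6 (ii) p.303 (PDF p.77)] -/
theorem exists_not_isGroupLikeObj :
    ∃ A : S.C, ¬ (PreFrobenioidData.ofModel S.tf.divisorMonoid S.tf.ratFnFunctor S.tf.divBNatTrans).IsGroupLikeObj A :=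
  S.tf.exists_not_isGroupLikeObj_ofModel

end BiKummerSetting

end Literature.AnabelianGeometry.EtaleTheta
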